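import Mathlib.Analysis.SpecialFunctions.Pow.Real
import Mathlib.Analysis.SpecialFunctions.Sqrt
import HarnessLib

/-!
# Fournais 2020, (2.33)–(2.35): the completion of the square behind Lemma 2.4

Topic `Literature/MathematicalPhysics/QuantumManyBody` (provefact
`Literature.MathematicalPhysics.QuantumManyBody.BoseGas.Fournais2020_condensation`, layer `Fournais2020_lemma24`).
The Bogoliubov-type bound [Fournais2020, Lemma 2.4] is obtained, momentum by momentum, from the
positivity of `(αb_p† + βb_{-p})(αb_p + βb_{-p}†) + (αb_{-p}† + βb_p)(αb_{-p} + βb_p†)` with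
"appropriately adjusted coefficients `α, β`" and the commutator bound `[b_p, b_p†] ≤ n` (2.28)
[Fournais2020, (2.33)–(2.34); FournaisSolovej2020, App. A], followed by the expansion of the square
root `𝒜 - √(𝒜² - Ŵ₁²) ≤ Ŵ₁²/(2𝒜) + CŴ₁⁴/𝒜³` (2.35)–(2.36). This file isolates the scalar content
of these two steps, which is all that the operators contribute once the expectations
`N = ‖b_pΦ‖² + ‖b_{-p}Φ‖²`, `M = ‖b_p†Φ‖² + ‖b_{-p}†Φ‖²` and the pairing
`P = Re⟨b_p†Φ, b_{-p}Φ⟩ + Re⟨b_{-p}†Φ, b_pΦ⟩` in a state `Φ` are formed: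

* `bogoliubov_completion`: if `α²N + β²M + 2αβP ≥ 0` for all real `α, β` (the square) and
  `M ≤ N + 2n‖Φ‖²` (the commutator bound, summed over `±p`; no sign conditions on `n, ‖Φ‖²` are
  needed for this step), then for `|W| ≤ 𝒜`,
  `𝒜N + WP ≥ -n(𝒜 - √(𝒜² - W²))‖Φ‖²` (2.33)–(2.34), with `α² = (𝒜 + √(𝒜²-W²))/2`,
  `β² = (𝒜 - √(𝒜²-W²))/2`, `αβ = W/2`;
* `sub_sqrt_sq_sub_sq_le`: `𝒜 - √(𝒜² - W²) ≤ W²/(2𝒜) + W⁴/(2𝒜³)` for `|W| ≤ 𝒜`, `0 < 𝒜`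
  (2.35) (with the explicit constant `½`; the identity `𝒜 - √(𝒜²-W²) = W²/(𝒜 + √(𝒜²-W²))`).

## References

* [Fournais2020] S. Fournais, *Length scales for BEC in the dilute Bose gas*, arXiv:2011.00309,
  EMS Ser. Congr. Rep. 18 (2021), doi:10.4171/ecr/18-1/7: Lemma 2.4, (2.28), (2.33)–(2.36).
* [FournaisSolovej2020] S. Fournais, J. P. Solovej, *The energy of dilute Bose gases*,
  Ann. of Math. 192 (2020) 893–976: App. A (the Bogoliubov method / completion of the square).
-/

noncomputable section

namespace Literature.MathematicalPhysics.QuantumManyBody.BoseGas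

/-- **The square-root identity** `𝒜 - √(𝒜² - W²) = W²/(𝒜 + √(𝒜² - W²))` (`|W| ≤ 𝒜`, `0 < 𝒜`).
[cite: Fournais2020, (2.35)] -/
theorem sub_sqrt_sq_sub_sq_eq {A W : ℝ} (hA : 0 < A) (hW : |W| ≤ A) :
    A - Real.sqrt (A ^ 2 - W ^ 2) = W ^ 2 / (A + Real.sqrt (A ^ 2 - W ^ 2)) := by
  have hD : 0 ≤ A ^ 2 - W ^ 2 := by nlinarith [abs_nonneg W, sq_abs W]
  have hs := Real.sqrt_nonneg (A ^ 2 - W ^ 2)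
  have hden : 0 < A + Real.sqrt (A ^ 2 - W ^ 2) := by linarith
  rw [eq_div_iff hden.ne']
  have h2 := Real.sq_sqrt hD
  nlinarith [h2]

/-- **(2.35): expanding the square root**, `𝒜 - √(𝒜² - W²) ≤ W²/(2𝒜) + W⁴/(2𝒜³)` for
`|W| ≤ 𝒜`, `0 < 𝒜` ("using that `|Ŵ₁(p)|/𝒜(p) ≤ ½` to expand the square root"; the bound holds in
the whole range `|W| ≤ 𝒜`). [cite: Fournais2020, (2.35)–(2.36)] -/
theorem sub_sqrt_sq_sub_sq_le {A W : ℝ} (hA : 0 < A) (hW : |W| ≤ A) :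
    A - Real.sqrt (A ^ 2 - W ^ 2) ≤ W ^ 2 / (2 * A) + W ^ 4 / (2 * A ^ 3) := by
  have hD : 0 ≤ A ^ 2 - W ^ 2 := by nlinarith [abs_nonneg W, sq_abs W]
  set s := Real.sqrt (A ^ 2 - W ^ 2) with hs_def
  have hs : 0 ≤ s := Real.sqrt_nonneg _
  have hs2 : s ^ 2 = A ^ 2 - W ^ 2 := Real.sq_sqrt hD
  have hden : 0 < A + s := by linarith
  have hAs : A - s = W ^ 2 / (A + s) := sub_sqrt_sq_sub_sq_eq hA hW
  rw [hAs]
  -- `W²/(A+s) = W²/(2A) + W²(A-s)/(2A(A+s))` and `W²(A-s) = W⁴/(A+s)`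
  have e1 : W ^ 2 / (A + s) = W ^ 2 / (2 * A) + W ^ 2 * (A - s) / (2 * A * (A + s)) := by
    field_simp
    ring
  have e2 : W ^ 2 * (A - s) / (2 * A * (A + s)) = W ^ 4 / (2 * A * (A + s) ^ 2) := by
    rw [hAs]
    field_simp
  have e3 : W ^ 4 / (2 * A * (A + s) ^ 2) ≤ W ^ 4 / (2 * A ^ 3) := by
    refine div_le_div_of_nonneg_left (by positivity) (by positivity) ?_
    have : A ^ 2 ≤ (A + s) ^ 2 := by nlinarith
    nlinarith
  rw [e1, e2]
  linarith [e3]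

/-- The coefficients of the completed square: for `|W| ≤ 𝒜` there are real `α, β` with
`α² = (𝒜 + √(𝒜²-W²))/2`, `β² = (𝒜 - √(𝒜²-W²))/2` and `αβ = W/2`. [cite: Fournais2020, (2.33)] -/
theorem exists_bogoliubov_coefficients {A W : ℝ} (hA : 0 < A) (hW : |W| ≤ A) :
    ∃ α β : ℝ, α ^ 2 = (A + Real.sqrt (A ^ 2 - W ^ 2)) / 2 ∧
      β ^ 2 = (A - Real.sqrt (A ^ 2 - W ^ 2)) / 2 ∧ α * β = W / 2 := by
  have hD : 0 ≤ A ^ 2 - W ^ 2 := by nlinarith [abs_nonneg W, sq_abs W]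
  set s := Real.sqrt (A ^ 2 - W ^ 2) with hs_def
  have hs : 0 ≤ s := Real.sqrt_nonneg _
  have hs2 : s ^ 2 = A ^ 2 - W ^ 2 := Real.sq_sqrt hD
  have hsA : s ≤ A := by nlinarith
  have hp : 0 ≤ (A + s) / 2 := by linarith
  have hm : 0 ≤ (A - s) / 2 := by linarith
  have hprod : Real.sqrt ((A + s) / 2) * Real.sqrt ((A - s) / 2) = |W| / 2 := by
    rw [← Real.sqrt_mul hp, show (A + s) / 2 * ((A - s) / 2) = (W / 2) ^ 2 by nlinarith [hs2],
      Real.sqrt_sq_eq_abs, abs_div, abs_two]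
  rcases le_or_gt 0 W with hW0 | hW0
  · refine ⟨Real.sqrt ((A + s) / 2), Real.sqrt ((A - s) / 2), Real.sq_sqrt hp, Real.sq_sqrt hm, ?_⟩
    rw [hprod, abs_of_nonneg hW0]
  · refine ⟨-Real.sqrt ((A + s) / 2), Real.sqrt ((A - s) / 2), by rw [neg_sq, Real.sq_sqrt hp],
      Real.sq_sqrt hm, ?_⟩
    rw [neg_mul, hprod, abs_of_neg hW0]
    ring

/-- **Fournais 2020, (2.33)–(2.34): the completion of the square.** In a state `Φ`, let
`N = ‖b_pΦ‖² + ‖b_{-p}Φ‖²`, `M = ‖b_p†Φ‖² + ‖b_{-p}†Φ‖²` and `P = Re⟨b_p†Φ, b_{-p}Φ⟩ + Re⟨b_{-p}†Φ, b_pΦ⟩`.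
The positivity of `‖(αb_p + βb_{-p}†)Φ‖² + ‖(αb_{-p} + βb_p†)Φ‖²` reads `α²N + β²M + 2αβP ≥ 0`, the
commutator bound `[b_{±p}, b_{±p}†] ≤ n` (2.28) reads `M ≤ N + 2n‖Φ‖²`, and then, for `|W| ≤ 𝒜`,
`𝒜 N + W P ≥ -n (𝒜 - √(𝒜² - W²)) ‖Φ‖²`. [cite: Fournais2020, (2.33)–(2.34), (2.28)]
[cite: FournaisSolovej2020, App. A] -/
theorem bogoliubov_completion {N M P normSq n A W : ℝ}
    (hsq : ∀ α β : ℝ, 0 ≤ α ^ 2 * N + β ^ 2 * M + 2 * α * β * P) (hcomm : M ≤ N + 2 * n * normSq)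
    (hA : 0 < A) (hW : |W| ≤ A) :
    -(n * (A - Real.sqrt (A ^ 2 - W ^ 2)) * normSq) ≤ A * N + W * P := by
  obtain ⟨α, β, hα, hβ, hαβ⟩ := exists_bogoliubov_coefficients hA hW
  have h := hsq α β
  have hβ0 : 0 ≤ β ^ 2 := sq_nonneg β
  have h2 : β ^ 2 * M ≤ β ^ 2 * N + β ^ 2 * (2 * n * normSq) := by
    have := mul_le_mul_of_nonneg_left hcomm hβ0
    rwa [mul_add] at this
  have h3 : 2 * α * β * P = W * P := by rw [mul_assoc 2 α β, hαβ]; ring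
  have h5 : 2 * β ^ 2 = A - Real.sqrt (A ^ 2 - W ^ 2) := by rw [hβ]; ring
  have h6 : β ^ 2 * (2 * n * normSq) = (A - Real.sqrt (A ^ 2 - W ^ 2)) * n * normSq := by
    rw [← h5]; ring
  have h7 : α ^ 2 * N + β ^ 2 * N = A * N := by rw [← add_mul, hα, hβ]; ring
  linarith [h, h2, h3, h6, h7]

/-- **The chain (2.33)–(2.36) in one stroke**: under the hypotheses of `bogoliubov_completion` and
`0 < 𝒜`, `𝒜N + WP ≥ -n(W²/(2𝒜) + W⁴/(2𝒜³))‖Φ‖²`. [cite: Fournais2020, (2.33)–(2.36)] -/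
theorem bogoliubov_completion_expanded {N M P normSq n A W : ℝ} (hn : 0 ≤ n) (hΦ : 0 ≤ normSq)
    (hsq : ∀ α β : ℝ, 0 ≤ α ^ 2 * N + β ^ 2 * M + 2 * α * β * P) (hcomm : M ≤ N + 2 * n * normSq)
    (hA : 0 < A) (hW : |W| ≤ A) :
    -(n * (W ^ 2 / (2 * A) + W ^ 4 / (2 * A ^ 3)) * normSq) ≤ A * N + W * P := by
  refine le_trans ?_ (bogoliubov_completion hsq hcomm hA hW)
  have h := sub_sqrt_sq_sub_sq_le hA hW
  have := mul_le_mul_of_nonneg_left h hn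
  nlinarith [mul_le_mul_of_nonneg_right this hΦ]

end Literature.MathematicalPhysics.QuantumManyBody.BoseGas

end
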